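import Mathlib
import Literature.Analysis.ODE.LinearComparison
import Summits.NavierStokesRegularity.NavierStokesRegularity.Theorems.SubOnsagerCeilingDyadicDampedChain
import Summits.NavierStokesRegularity.NavierStokesRegularity.Theorems.SubOnsagerCeilingDyadicDampedRegionForced
import HarnessLib

/-!
# The damped chain barrier — variant with a FORCED datum shell and an ENERGY normalisation,
# scale ratios `b ∈ [19/10, 2]` (helper file for crux stmt-NavierStokesRegularity-27057, `--supports … --as helper`;
# LEAD SOC census v6 §C: the CHAIN HALF of the joint region «chain + slaved side drain»)

**Variant of `chain_shellBarrier_damped` (sibling file)** for the side-branch class: the chain's datum shell may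
be FORCED (the damping `E₀(t)` at shell `0` has no sign: a negative side datum pumps energy into the chain's
datum shell), so the barrier is normalised by any a-priori bound `Ē ≥ |Z₀(t)|` on the window (on Tao's lattice:
the energy bound `√(2E₀)`, `orthantBreak_energy_le`) instead of `|x₀|`; non-negativity of `E_k` is required
for `k ≥ 1` only; the region lemma is the forced variant `invariantRegion_le_one_of_tail_damped'`.

**What is proved (`chain_shellBarrier_damped'`).** Let `b ∈ [19/10, 2]`, `c₀ > 0`, `ν > 0`, and let
`Z_k : [0, s] → ℝ` (`k ≥ -1`, `Z_{-1} ≡ 0`) solve the DAMPED NS-scaled viscous chain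
`Ż_k = c₀(b^{5(k-1)/2} Z²_{k-1} − b^{5k/2} Z_k Z_{k+1}) − E_k(t) Z_k − ν b^{2k} Z_k` on `[0, s]` from the
one-shell datum `Z_k(0) = x₀·1_{k=0}` (continuous, non-negative on the shells `k ≥ 1`, Tao's weight bound),
where the extra damping rates `E_k` are continuous, NON-NEGATIVE and bounded by ONE FIFTH OF THE CHAIN'S OWN
RATE SCALE at the barrier: `E_k(t) ≤ 2 c₀ |x₀| b^{2θ-5/2} (b^{5/2-θ})^k` (`θ = 101/200`). Then for all
`t ∈ [0, s]` and `k ≥ 0`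

  `b^{2θk} Z_k(t)² ≤ 100 · x₀²`,

uniformly in `ν`, `s`, and in the damping. ON TAO'S LATTICE `E_k = P(1+ε₀)^{5k/2} s_k` is the in-shell drain
that a KP network proper exerts on its chain through a side source `s_k` pumped with weight `P`; the
hypothesis reads `s_k ≤ (2c₀/P) b^{2θ-5/2}·|x₀| b^{-θk}` — a weighted envelope for the side source of the
same shape as the chain's (`|Z_k| ≤ 10|x₀| b^{-θk}`), which is what the pair slaving lemma
(`kpProper_pairSlaving`, p646904) produces from the chain envelope when `P·(P/w)^{1/2}` is small. The
joint bootstrap (chain envelope ⇒ side envelope ⇒ damping bound ⇒ chain envelope) is NOT in this file.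

**Proof.** g3's `DyadicRange.chain_shellBarrier` verbatim (rescaling `Y_{k+1} = A b^{θk} σ_k Z_k`,
`A = δ/(|x₀| + η)`; all its bookkeeping lemmas are reused by name), with the region lemma replaced by the
damped one `DyadicDamped.invariantRegion_le_one_of_tail_damped` (p649296: two-sided squeeze
`G − F Y/5 ≤ Ẏ ≤ G`, threshold `p ≥ 47/25`): in rescaled variables the damping is `−E_k Y_{k+1}` (time is
not rescaled) and `E_k ≤ F_{k+1}/5` is exactly the displayed hypothesis (`1/A ≥ 10|x₀|`).

HONEST FRAMING: MODEL lattice ODE statement (an ingredient of a rung under crux `ForwardTailCeilingKP` of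
route SubOnsagerCeiling, TL-M2Break); by itself it proves no class of tables; nothing here bears on
Navier–Stokes regularity and no crux or summit is proved.
[cite: BarbatoMorandinRomito2011, §2 Lemma 2.1, §3.2 proof of Thm. 1] [cite: Tao2016AveragedNS, §4 (4.5), (4.13)]
-/

noncomputable section

-- the sub-problem namespace `NavierStokesRegularity.NavierStokesRegularity` is the tree's layout (D-0017)
set_option linter.dupNamespace false

namespace Summit.NavierStokesRegularity.NavierStokesRegularity.Theorems.DyadicDamped

open Set Filter Topology
open Summit.NavierStokesRegularity.NavierStokesRegularity.Theorems.DyadicRange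

/-! ## The damped chain barrier -/

set_option maxHeartbeats 400000 in
/-- **The ν-uniform shell barrier for the positive viscous Katz–Pavlović chain under an extra bounded
damping, scale ratio `b ∈ [19/10, 2]`** (see the module docstring): `b^{2θk}Z_k(t)² ≤ 100·x₀²`,
`θ = 101/200`, along every solution on `[0, s]` from the one-shell datum `x₀`, for every viscosity
`ν > 0`, coupling `c₀ > 0`, and continuous damping rates `0 ≤ E_k(t) ≤ 2c₀|x₀|b^{2θ-5/2}(b^{5/2-θ})^k`.
[cite: BarbatoMorandinRomito2011, §2 Lemma 2.1 and §3.2] -/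
theorem chain_shellBarrier_damped' {b c₀ ν s x₀ Eb : ℝ} (hb : 19 / 10 ≤ b) (hb2 : b ≤ 2) (hc₀ : 0 < c₀)
    (hν : 0 < ν) (hs : 0 < s) {Z : ℤ → ℝ → ℝ} {E : ℕ → ℝ → ℝ}
    (hdat : ∀ k : ℤ, Z k 0 = if k = 0 then x₀ else 0)
    (hvan : ∀ t, Z (-1) t = 0)
    (hbdd : ∃ M : ℝ, ∀ (t : ℝ) (k : ℕ), (1 + b ^ ((10 : ℝ) * k)) * |Z k t| ≤ M)
    (hcont : ∀ k : ℕ, ContinuousOn (Z k) (Icc 0 s))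
    (hEcont : ∀ k : ℕ, ContinuousOn (E k) (Icc 0 s))
    (hZ0 : ∀ t ∈ Icc 0 s, |Z 0 t| ≤ Eb)
    (hE0 : ∀ k : ℕ, 1 ≤ k → ∀ t ∈ Icc 0 s, 0 ≤ E k t)
    (hEb : ∀ k : ℕ, ∀ t ∈ Icc 0 s, E k t ≤
      2 * c₀ * Eb * ((b ^ ((101 : ℝ) / 200)) ^ 2 / b ^ ((5 : ℝ) / 2)) *
        (b ^ ((5 : ℝ) / 2) / b ^ ((101 : ℝ) / 200)) ^ k)
    (hode : ∀ k : ℕ, ∀ t ∈ Icc 0 s, HasDerivWithinAt (Z k)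
      (c₀ * (b ^ ((5 : ℝ) * ((k : ℝ) - 1) / 2) * Z ((k : ℤ) - 1) t ^ 2 -
          b ^ ((5 : ℝ) * (k : ℝ) / 2) * (Z k t * Z ((k : ℤ) + 1) t)) - E k t * Z k t -
        ν * b ^ ((2 : ℝ) * (k : ℝ)) * Z k t) (Icc 0 s) t)
    (hnn : ∀ t ∈ Icc 0 s, ∀ k : ℕ, 1 ≤ k → 0 ≤ Z k t) :
    ∀ t ∈ Icc 0 s, ∀ k : ℕ, (b ^ ((101 : ℝ) / 200)) ^ (2 * k) * Z k t ^ 2 ≤ 100 * Eb ^ 2 := by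
  intro t ht k
  have hEb0 : 0 ≤ Eb := (abs_nonneg _).trans (hZ0 0 ⟨le_rfl, hs.le⟩)
  have hx₀E : |x₀| ≤ Eb := by have := hZ0 0 ⟨le_rfl, hs.le⟩; rwa [hdat 0, if_pos rfl] at this
  have hb0 : 0 < b := by linarith
  have hb1 : 1 ≤ b := by linarith
  -- the constants
  set B₁ : ℝ := b ^ ((101 : ℝ) / 200) with hB₁
  set B₅ : ℝ := b ^ ((5 : ℝ) / 2) with hB₅
  have hB₁0 : 0 < B₁ := Real.rpow_pos_of_pos hb0 _
  have hB₅0 : 0 < B₅ := Real.rpow_pos_of_pos hb0 _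
  set L : ℝ := B₅ / B₁ with hL
  set p : ℝ := B₅ / B₁ ^ 3 with hp
  have hL0 : 0 < L := div_pos hB₅0 hB₁0
  have hp0 : 0 < p := div_pos hB₅0 (pow_pos hB₁0 3)
  -- `p = b^{197/200} ≥ 47/25`, `p² ≤ L`
  obtain ⟨hp47, hpL⟩ : 47 / 25 ≤ p ∧ p ^ 2 ≤ L := ratio_consts_damped hb
  set c : ℝ := p⁻¹ with hc
  have hpc : p * c = 1 := mul_inv_cancel₀ hp0.ne'
  -- powers of `b` along the shells
  have hΛ : ∀ k : ℕ, b ^ ((5 : ℝ) * (k : ℝ) / 2) = B₅ ^ k := by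
    intro k
    rw [hB₅, ← Real.rpow_mul_natCast hb0.le]; congr 1; ring
  have hΛ' : ∀ k : ℕ, b ^ ((5 : ℝ) * ((k : ℝ) - 1) / 2) = B₅ ^ k / B₅ := by
    intro k
    rw [show (5 : ℝ) * ((k : ℝ) - 1) / 2 = (5 : ℝ) * (k : ℝ) / 2 - 5 / 2 by ring, Real.rpow_sub hb0,
      hΛ k]
  have h2k : ∀ k : ℕ, b ^ ((2 : ℝ) * (k : ℝ)) = (b ^ 2) ^ k := by
    intro k
    rw [Real.rpow_mul_natCast hb0.le, Real.rpow_two]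
  -- the sign of the datum shell
  set σ : ℝ := if 0 ≤ x₀ then 1 else -1 with hσ
  have hσ2 : σ ^ 2 = 1 := by rw [hσ]; split_ifs <;> norm_num
  have hσa : σ * x₀ = |x₀| := by
    rw [hσ]; split_ifs with h
    · rw [abs_of_nonneg h, one_mul]
    · rw [abs_of_neg (not_le.1 h)]; ring
  -- the datum shell keeps its sign on `[0, s]`: `g = σ Z₀` solves `ġ = -(c₀ Z₁ + ν) g`
  have hg_nonneg : ∀ τ ∈ Icc 0 s, 0 ≤ σ * Z 0 τ := by
    have hode0 : ∀ r ∈ Ico 0 s, HasDerivWithinAt (fun r => σ * Z 0 r)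
        (0 + (-(c₀ * (Z 1 r + E 0 r / c₀) + ν)) * (σ * Z 0 r)) (Ici r) r := by
      intro r hr
      have h := hode 0 r (Ico_subset_Icc_self hr)
      have e1 : ((0 : ℕ) : ℤ) - 1 = -1 := by norm_num
      have e2 : ((0 : ℕ) : ℤ) + 1 = 1 := by norm_num
      rw [e1, e2, hvan r] at h
      have h' := (h.mono_of_mem_nhdsWithin (Icc_mem_nhdsGE_of_mem hr)).const_mul σ
      refine h'.congr_deriv ?_
      have e3 : b ^ ((5 : ℝ) * ((0 : ℕ) : ℝ) / 2) = 1 := by simp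
      have e4 : b ^ ((2 : ℝ) * ((0 : ℕ) : ℝ)) = 1 := by simp
      rw [e3, e4]
      field_simp
      ring
    have hcg : ContinuousOn (fun r => σ * Z 0 r) (Icc 0 s) := continuousOn_const.mul (hcont 0)
    have hZ1' : ContinuousOn (fun r => Z 1 r + E 0 r / c₀) (Icc 0 s) :=
      (hcont 1).add ((hEcont 0).div_const c₀)
    have h00 : 0 ≤ σ * Z 0 0 := by rw [hdat 0, if_pos rfl, hσa]; exact abs_nonneg _
    exact datum_sign_nonneg hcg hZ1' hode0 h00
  -- the weight bound
  obtain ⟨M, hM⟩ := hbdd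
  have hM0 : 0 ≤ M := le_trans (mul_nonneg (by positivity) (abs_nonneg _)) (hM 0 0)
  -- the bound for every `η > 0`
  suffices main : ∀ η : ℝ, 0 < η → B₁ ^ (2 * k) * Z k t ^ 2 ≤ 100 * (Eb + η) ^ 2 by
    have hlim : Tendsto (fun η : ℝ => 100 * (Eb + η) ^ 2) (𝓝[>] 0) (𝓝 (100 * (Eb + 0) ^ 2)) :=
      ((tendsto_nhdsWithin_of_tendsto_nhds (f := fun η : ℝ => 100 * (Eb + η) ^ 2)
        (Continuous.tendsto (by continuity) 0)))
    rw [add_zero] at hlim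
    exact ge_of_tendsto hlim (eventually_nhdsWithin_of_forall fun η hη => main η hη)
  intro η hη
  have hxη : 0 < Eb + η := by positivity
  set A : ℝ := 1 / 10 / (Eb + η) with hA
  have hA0 : 0 < A := by positivity
  -- the rescaled chain
  set sg : ℕ → ℝ := fun k => if k = 0 then σ else 1 with hsg
  have hsg2 : ∀ k, sg k ^ 2 = 1 := by intro k; rw [hsg]; dsimp only; split_ifs; exact hσ2; norm_num
  set Y : ℕ → ℝ → ℝ := fun n τ =>
    if n = 0 then 0 else A * B₁ ^ (n - 1) * (sg (n - 1) * Z ((n - 1 : ℕ) : ℤ) τ) with hY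
  have hY0 : ∀ τ, Y 0 τ = 0 := fun τ => by simp [hY]
  have hYs : ∀ (k : ℕ) (τ : ℝ), Y (k + 1) τ = A * B₁ ^ k * (sg k * Z k τ) := by
    intro k τ; simp [hY]
  have hY1 : ∀ τ, Y 1 τ = A * (σ * Z 0 τ) := fun τ => by
    rw [show (1 : ℕ) = 0 + 1 from rfl, hYs]; simp [hsg]
  have hY2 : ∀ (j : ℕ) (τ : ℝ), Y (j + 2) τ = A * B₁ ^ (j + 1) * Z ((j + 1 : ℕ) : ℤ) τ := by
    intro j τ; rw [show j + 2 = (j + 1) + 1 from rfl, hYs]; simp [hsg]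
  set b2 : ℝ := b ^ 2 with hb2def
  have hb20 : 0 < b2 := by rw [hb2def]; positivity
  have hb21 : 1 ≤ b2 := by rw [hb2def]; exact one_le_pow₀ hb1
  have hb24 : b2 ≤ 4 := by rw [hb2def]; nlinarith
  set G : ℝ := c₀ / A * (B₁ ^ 2 / B₅) with hG
  have hG0 : 0 < G := by rw [hG]; positivity
  set κ : ℕ → ℝ := fun n => ν * b2 ^ n / b2 with hκ
  set F : ℕ → ℝ := fun n => G * L ^ n / L with hF
  obtain ⟨hκpos, hκmono, hκ4, hκs0⟩ :
      (∀ n, 0 < κ n) ∧ (∀ n, κ n ≤ κ (n + 1)) ∧ (∀ n, κ (n + 1) ≤ 4 * κ n) ∧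
        (∀ k : ℕ, κ (k + 1) = ν * b2 ^ k) := kappa_facts hν hb20 hb21 hb24
  obtain ⟨hFpos, hFL, hFs0⟩ :
      (∀ n, 0 < F n) ∧ (∀ n, F (n + 1) = L * F n) ∧ (∀ k : ℕ, F (k + 1) = G * L ^ k) :=
    prod_facts hG0 hL0
  have hκs : ∀ k : ℕ, κ (k + 1) = ν * b2 ^ k := hκs0
  have hFs : ∀ k : ℕ, F (k + 1) = G * L ^ k := hFs0
  -- continuity, positivity, datum
  have hYcont : ∀ n, ContinuousOn (Y n) (Icc 0 s) := by
    intro n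
    rcases n with _ | k
    · have : Y 0 = fun _ => 0 := funext hY0
      rw [this]; exact continuousOn_const
    · have : Y (k + 1) = fun τ => A * B₁ ^ k * (sg k * Z k τ) := funext (hYs k)
      rw [this]
      exact continuousOn_const.mul (continuousOn_const.mul (hcont k))
  have hYpos : ∀ n, ∀ τ ∈ Icc 0 s, 0 ≤ Y n τ := by
    intro n τ hτ
    rcases n with _ | k
    · rw [hY0]
    rcases k with _ | j
    · rw [hY1]; exact mul_nonneg hA0.le (hg_nonneg τ hτ)
    · rw [hY2]; exact mul_nonneg (by positivity) (hnn τ hτ (j + 1) (by omega))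
  have hYinit : ∀ n, Y n 0 ≤ 1 / 10 := by
    intro n
    rcases n with _ | k
    · rw [hY0]; norm_num
    rcases k with _ | j
    · have hAx : A * |x₀| ≤ 1 / 10 := by
        rw [hA, div_mul_eq_mul_div, div_le_iff₀ hxη]
        linarith [abs_nonneg x₀, hx₀E]
      rw [hY1, hdat 0, if_pos rfl, hσa]; exact hAx
    · have hne : (((j + 1 : ℕ) : ℤ)) ≠ 0 := Int.natCast_ne_zero.mpr (Nat.succ_ne_zero j)
      rw [hY2, hdat, if_neg hne, mul_zero]; norm_num
  -- the datum shell is quiescent (a-priori bound `|Z₀| ≤ Ē`)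
  have hY1small : ∀ τ ∈ Icc 0 s, Y 1 τ ≤ 1 / 10 := by
    intro τ hτ
    rw [hY1]
    have h1 : σ * Z 0 τ ≤ |Z 0 τ| := by
      have := le_abs_self (σ * Z 0 τ)
      have hs1 : |σ| = 1 := by rw [hσ]; split_ifs <;> norm_num
      rwa [abs_mul, hs1, one_mul] at this
    have h2 : A * |Z 0 τ| ≤ 1 / 10 := by
      rw [hA, div_mul_eq_mul_div, div_le_iff₀ hxη]
      linarith [hZ0 τ hτ, abs_nonneg (Z 0 τ)]
    nlinarith [mul_le_mul_of_nonneg_left h1 hA0.le]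
  -- the quiescent tail (Tao's weight bound (4.5))
  have hbt : 0 < b ^ (10 : ℝ) := Real.rpow_pos_of_pos hb0 _
  set q : ℝ := B₁ / b ^ (10 : ℝ) with hq
  have hq0 : 0 ≤ q := by rw [hq]; positivity
  have hq1 : q < 1 := by
    rw [hq, div_lt_one hbt, hB₁]
    exact Real.rpow_lt_rpow_of_exponent_lt (by linarith) (by norm_num)
  have hZle : ∀ (k : ℕ) (τ : ℝ), (b ^ (10 : ℝ)) ^ k * |Z k τ| ≤ M := by
    intro k τ
    have h := hM τ k
    rw [Real.rpow_mul_natCast hb0.le] at h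
    have h0 : 0 ≤ |Z k τ| := abs_nonneg _
    have h1 : (1 + (b ^ (10 : ℝ)) ^ k) * |Z k τ| = |Z k τ| + (b ^ (10 : ℝ)) ^ k * |Z k τ| := by ring
    linarith
  have hYle' : ∀ (k : ℕ) (τ : ℝ), Y (k + 1) τ ≤ A * M * q ^ k := by
    intro k τ
    rw [hYs]
    have hs : |sg k| = 1 := by
      rw [hsg]; dsimp only; split_ifs
      · rw [hσ]; split_ifs <;> norm_num
      · norm_num
    have h1 : sg k * Z k τ ≤ |Z k τ| := by
      have := le_abs_self (sg k * Z k τ)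
      rwa [abs_mul, hs, one_mul] at this
    have h2 : B₁ ^ k * |Z k τ| = q ^ k * ((b ^ (10 : ℝ)) ^ k * |Z k τ|) := by
      rw [hq, div_pow]; field_simp
    have h3 : q ^ k * ((b ^ (10 : ℝ)) ^ k * |Z k τ|) ≤ q ^ k * M :=
      mul_le_mul_of_nonneg_left (hZle k τ) (pow_nonneg hq0 k)
    calc A * B₁ ^ k * (sg k * Z k τ) ≤ A * B₁ ^ k * |Z k τ| :=
          mul_le_mul_of_nonneg_left h1 (by positivity)
      _ = A * (B₁ ^ k * |Z k τ|) := by ring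
      _ = A * (q ^ k * ((b ^ (10 : ℝ)) ^ k * |Z k τ|)) := by rw [h2]
      _ ≤ A * (q ^ k * M) := mul_le_mul_of_nonneg_left h3 hA0.le
      _ = A * M * q ^ k := by ring
  obtain ⟨K, hK⟩ := geometric_tail_small hq0 hq1 (show 0 ≤ A * M by positivity)
  have hYtail : ∀ n, K + 1 ≤ n → ∀ τ ∈ Icc 0 s, Y n τ ≤ 1 / 10 := by
    intro n hn τ _
    obtain ⟨k, rfl⟩ : ∃ k, n = k + 1 := ⟨n - 1, by omega⟩
    exact (hYle' k τ).trans (hK k (by omega))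
  -- the equations of motion of the rescaled chain (damped)
  set Y' : ℕ → ℝ → ℝ := fun n τ =>
    -κ n * Y n τ + F n * (Y (n - 1) τ ^ 2 - p * Y n τ * Y (n + 1) τ) - E (n - 1) τ * Y n τ with hY'
  have hYderiv : ∀ n, 1 ≤ n → ∀ τ ∈ Ico 0 s, HasDerivWithinAt (Y n) (Y' n τ) (Ici τ) τ := by
    intro n hn τ hτ
    obtain ⟨k, rfl⟩ : ∃ k, n = k + 1 := ⟨n - 1, by omega⟩
    have h := hode k τ (Ico_subset_Icc_self hτ)
    rw [hΛ' k, hΛ k, h2k k] at h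
    have h' := (h.mono_of_mem_nhdsWithin (Icc_mem_nhdsGE_of_mem hτ)).const_mul (A * B₁ ^ k * sg k)
    have hfun : Y (k + 1) = fun r => A * B₁ ^ k * sg k * Z k r := by
      funext r; rw [hYs]; ring
    rw [hfun]
    refine h'.congr_deriv ?_
    simp only [hY', Nat.add_sub_cancel]
    rw [hκs k, hFs k, show k + 1 + 1 = k + 2 from rfl, hY2 k, hYs k]
    have ek : ((k : ℕ) : ℤ) + 1 = (((k + 1 : ℕ)) : ℤ) := by push_cast; ring
    rw [ek]
    rcases k with _ | j
    · -- the datum shell: no feed (`Z_{-1} = 0`, `Y_0 = 0`)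
      have e1 : ((0 : ℕ) : ℤ) - 1 = -1 := by norm_num
      rw [e1, hvan τ, hY0, hG, hL, hp]
      linear_combination rescale_identity_zero A B₁ B₅ c₀ ν (sg 0) (Z 0 τ) (Z ((0 + 1 : ℕ) : ℤ) τ)
        hA0.ne' hB₁0.ne' hB₅0.ne'
    · have e1 : (((j + 1 : ℕ)) : ℤ) - 1 = ((j : ℕ) : ℤ) := by push_cast; ring
      have es1 : sg (j + 1) = 1 := by simp [hsg]
      rw [e1, hYs j, es1, hG, hL, hp]
      linear_combination rescale_identity_succ A B₁ B₅ c₀ ν b2 (sg j) (Z j τ)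
        (Z ((j + 1 : ℕ) : ℤ) τ) (Z ((j + 1 + 1 : ℕ) : ℤ) τ) j hA0.ne' hB₁0.ne' hB₅0.ne' (hsg2 j)
  -- the squeeze: `G − F Y/5 ≤ Y' ≤ G`
  have hYup : ∀ n, 2 ≤ n → ∀ τ ∈ Ico 0 s,
      Y' n τ ≤ -κ n * Y n τ + F n * (Y (n - 1) τ ^ 2 - p * Y n τ * Y (n + 1) τ) := by
    intro n hn τ hτ
    simp only [hY']
    have h1 : 0 ≤ E (n - 1) τ * Y n τ :=
      mul_nonneg (hE0 (n - 1) (by omega) τ (Ico_subset_Icc_self hτ)) (hYpos n τ (Ico_subset_Icc_self hτ))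
    linarith
  have hYlo : ∀ n, 1 ≤ n → ∀ τ ∈ Ico 0 s,
      -κ n * Y n τ + F n * (Y (n - 1) τ ^ 2 - p * Y n τ * Y (n + 1) τ) - 1 / 5 * F n * Y n τ ≤ Y' n τ := by
    intro n hn τ hτ
    obtain ⟨k, rfl⟩ : ∃ k, n = k + 1 := ⟨n - 1, by omega⟩
    simp only [hY', Nat.add_sub_cancel]
    have hYk : 0 ≤ Y (k + 1) τ := hYpos (k + 1) τ (Ico_subset_Icc_self hτ)
    -- `E_k ≤ F_{k+1}/5`
    have hEF : E k τ ≤ 1 / 5 * F (k + 1) := by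
      have h1 := hEb k τ (Ico_subset_Icc_self hτ)
      rw [hFs k, hG]
      have hx10 : 2 * c₀ * Eb ≤ 1 / 5 * (c₀ / A) := by
        have hAinv : 1 / 5 * (c₀ / A) = 2 * c₀ * (Eb + η) := by
          rw [hA, div_div_eq_mul_div]; ring
        rw [hAinv]
        linarith only [mul_pos hc₀ hη]
      have h2 : 2 * c₀ * Eb * (B₁ ^ 2 / B₅) * L ^ k ≤ 1 / 5 * (c₀ / A) * (B₁ ^ 2 / B₅) * L ^ k :=
        mul_le_mul_of_nonneg_right (mul_le_mul_of_nonneg_right hx10 (by positivity)) (pow_nonneg hL0.le k)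
      linarith only [h1, h2]
    have := mul_le_mul_of_nonneg_right hEF hYk
    linarith only [this]
  -- the damped region lemma: `Y ≤ 1`
  have hYle : ∀ n, ∀ τ ∈ Icc 0 s, Y n τ ≤ 1 :=
    invariantRegion_le_one_of_tail_damped' hs hκpos hκmono hκ4 hFpos hFL hp47 hpL hpc (le_refl (1 / 5 : ℝ))
      hY0 hYcont hYderiv hYup hY1small hYlo hYpos hYinit hYtail
  -- conclusion at the shell `k`
  exact unscale_bound hxη hA (hYs k t) (hsg2 k) (hYpos (k + 1) t ht) (hYle (k + 1) t ht)

end Summit.NavierStokesRegularity.NavierStokesRegularity.Theorems.DyadicDamped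

end
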